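import Mathlib
import Literature.Analysis.FluidPDE.CurlFreeLiouville
import Literature.Analysis.FluidPDE.NSBoundedMildOseenClassical
import Summits.NavierStokesRegularity.OSWSelfSimilar.TypeIIInnerLimitVorticity
import HarnessLib
/-!
# The (α)/(β) DISCRIMINATOR is the vorticity of the inner object (zone Z1 TEMPLATE §T1.4 (C9)/(G4):
# «the discriminator (α)/(β): liminf μ_ωu = 0 vs > 0», kernel, unconditional)

HONEST FRAMING (cell ns-blowup GROUP B «PROFILE SEARCH», zone Z1; D-0035/D-0074): part XXX of the Z1 dictionary. Part XXIX
made the zoomed vorticity `λₖ²ω(tₖ + λₖ²s, cₖ + λₖy)` converge to `curl W(s)(y)` and showed (α) ⇒ it tends to `0`. This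
file proves the converse direction, so that the TEMPLATE's discriminator (C9) becomes an EQUIVALENCE by decl: a KNSS
blow-up limit is of type (β) (one non-constant slice) IF AND ONLY IF it carries vorticity (`curl W(s)(y) ≠ 0` somewhere)
— because a smooth bounded slice with `curl = 0` and `div = 0` is constant (the tree's Liouville theorem for bounded
irrotational incompressible fields `eq_of_curl_eq_zero_of_isDivFree_of_bounded`, KNSS 2009 Lemma 3.1 / end of the proofs
of Thms 5.1–5.2; the weak divergence-freeness of the duality class upgraded pointwise by
`IsWeaklyDivFree.isDivFree_of_contDiff`).

* `knssBlowupLimit_contDiff_slice`, `knssBlowupLimit_isDivFree_slice` — slices of the inner object are `C^∞` and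
  (pointwise) divergence free;
* `knssBlowupLimit_const_of_curl_eq_zero` — an inner object with irrotational slices is slice-wise constant (type (α));
* `knssBlowupLimit_typeBeta_iff_exists_curl_ne_zero` — **(β) ⇔ the inner object carries vorticity**;
* `innerLimit_discriminator_of_singularity` — the census sentence with the DISCRIMINATOR: on K8's standing hypotheses
  verbatim, along the subsequence of part XXIX the zoomed vorticity converges pointwise to `curl W`, and EITHER (α) it
  tends to `0` EVERYWHERE on `(−∞, 0) × ℝ³` (and `W ≡ c`, unit, `c₁ = 0`) OR (β) it tends to a NON-ZERO value SOMEWHERE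
  (and `W` is the (AX-L) counterexample with the (I-5) signature) — «μ_ωu → 0» versus «μ_ωu ↛ 0» at the velocity scale.

**Nothing here asserts that a singular solution exists or that (AX-L) holds or fails.** «violates: n/a — dictionary»;
bears_on LADDER-NS N5/Z1 → N1 linear core / N0⁻ ((I-4), (C9)/(G4)). Author: ns-blowup-profile-eng-1 g8, 2026-08-27.
-/

open Real Filter Topology Set MeasureTheory Function Bornology
open scoped ENNReal NNReal ContDiff
open Literature.Analysis.FluidPDE

namespace Summit.NavierStokesRegularity.OSWSelfSimilar
namespace TypeIIModulationDictionary

section Discriminator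

variable {T Mₛ : ℝ} {u : ℝ → EuclideanSpace ℝ (Fin 3) → EuclideanSpace ℝ (Fin 3)}
  {p : ℝ → EuclideanSpace ℝ (Fin 3) → ℝ} {W : ℝ → EuclideanSpace ℝ (Fin 3) → EuclideanSpace ℝ (Fin 3)}

/-- Slices of a KNSS blow-up limit are `C^∞` (joint smoothness on `(−∞, 0) × ℝ³` composed with `y ↦ (s, y)`).
[new here — bookkeeping] -/
theorem knssBlowupLimit_contDiff_slice (hW : IsKNSSBlowupLimit W) {s : ℝ} (hs : s < 0) : ContDiff ℝ ∞ (W s) :=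
  hW.smooth.comp_contDiff (contDiff_prodMk_right s) fun y => ⟨hs, mem_univ y⟩

/-- Slices of a KNSS blow-up limit are (pointwise) divergence free: the duality class has weakly divergence-free slices,
and a `C¹` weakly divergence-free field is divergence free (`IsWeaklyDivFree.isDivFree_of_contDiff`). [new here —
bookkeeping] -/
theorem knssBlowupLimit_isDivFree_slice (hW : IsKNSSBlowupLimit W) {s : ℝ} (hs : s < 0) :
    VectorCalculus.IsDivFree (W s) :=
  (hW.isBoundedAncientMildSolution.1.1 s hs).isDivFree_of_contDiff
    (contDiff_infty.1 (knssBlowupLimit_contDiff_slice hW hs) 1)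

/-- **An inner object with irrotational slices is of type (α)**: if `curl W(s) ≡ 0` for every `s < 0`, then every slice is
constant in space — the tree's Liouville theorem for bounded irrotational incompressible `C²` fields
(`eq_of_curl_eq_zero_of_isDivFree_of_bounded`: `curl = 0 ∧ div = 0 ⇒ ΔW = 0`, bounded harmonic ⇒ constant).
[new here — dictionary; composes `eq_of_curl_eq_zero_of_isDivFree_of_bounded`] -/
theorem knssBlowupLimit_const_of_curl_eq_zero (hW : IsKNSSBlowupLimit W)
    (hcurl : ∀ s < 0, ∀ y : EuclideanSpace ℝ (Fin 3), curl (W s) y = 0) :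
    ∀ s < 0, ∀ y : EuclideanSpace ℝ (Fin 3), W s y = W s 0 := fun s hs y =>
  eq_of_curl_eq_zero_of_isDivFree_of_bounded (contDiff_infty.1 (knssBlowupLimit_contDiff_slice hW hs) 2)
    (hcurl s hs) (knssBlowupLimit_isDivFree_slice hW hs) (fun x => hW.norm_le_one s hs x) y 0

/-- **TEMPLATE (C9)/(G4) DISCRIMINATOR BY DECL: type (β) ⇔ the inner object carries vorticity.** For a KNSS blow-up
limit `W`: some slice is non-constant IFF `curl W(s)(y) ≠ 0` for some `s < 0`, `y`. [new here — dictionary] -/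
theorem knssBlowupLimit_typeBeta_iff_exists_curl_ne_zero (hW : IsKNSSBlowupLimit W) :
    (∃ s < 0, ∃ x : EuclideanSpace ℝ (Fin 3), W s x ≠ W s 0) ↔
      ∃ s < 0, ∃ y : EuclideanSpace ℝ (Fin 3), curl (W s) y ≠ 0 := by
  constructor
  · intro hnc
    by_contra h
    push Not at h
    obtain ⟨s, hs, x, hx⟩ := hnc
    exact hx (knssBlowupLimit_const_of_curl_eq_zero hW h s hs x)
  · rintro ⟨s, hs, y, hy⟩
    by_contra h
    push Not at h
    have hc : W s = fun _ => W s 0 := funext (h s hs)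
    exact hy (by rw [hc, curl_eq_curlCLM, fderiv_const_apply, map_zero])

/-- **THE Z1 CENSUS SENTENCE WITH THE (C9) DISCRIMINATOR (unconditional).** On K8's standing hypotheses verbatim —
`IsMaximalSmoothSolution 1 0 u p T⋆` (`T⋆ > 0`), `IsLerayHopfOn T⋆ 1 0 (u 0) u`, bounded on every closed sub-slab,
axisymmetric slices, `|Γ(0, ·)| ≤ Mₛ` — there are gauge N-a zoom data and a subsequence along which the zoom converges
slice-wise locally uniformly to a KNSS blow-up limit `W` (with its Oseen identity) and the zoomed vorticity
`λₖ²ω(tₖ + λₖ²s, cₖ + λₖy) → curl W(s)(y)` pointwise, and EXACTLY ONE of: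
(α) the zoomed vorticity tends to `0` at EVERY `(s, y)`, `s < 0` («μ_ωu → 0», velocity-dominated), `W ≡ c`, `‖c‖ = 1`,
`c₁ = 0`; or
(β) the zoomed vorticity tends to a NON-ZERO limit at SOME `(s, y)` («μ_ωu ↛ 0», one-scale), and `W` is a counterexample
to `AxisymmetricLiouvilleBoundedSwirl` with the (I-5) signature (swirl present, `r‖W_pol‖` unbounded,
`Γ_W ∉ L^∞_sL^q`, `Γ_W` non-decaying). [new here — dictionary; unconditional] -/
theorem innerLimit_discriminator_of_singularity (hT : 0 < T) (hmax : IsMaximalSmoothSolution 1 0 u p T)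
    (hLH : IsLerayHopfOn T 1 0 (u 0) u) (hbdd : ∀ S < T, ∃ N : ℝ, 0 < N ∧ ∀ t ∈ Icc 0 S, ∀ x, ‖u t x‖ ≤ N)
    (haxi : ∀ t, IsAxisymmetric (u t)) (hMₛ : ∀ x, |swirl (u 0) x| ≤ Mₛ) :
    ∃ (tn lamn : ℕ → ℝ) (cn : ℕ → EuclideanSpace ℝ (Fin 3)) (φ : ℕ → ℕ)
      (W : ℝ → EuclideanSpace ℝ (Fin 3) → EuclideanSpace ℝ (Fin 3)),
      (∀ k, T / 2 ≤ tn k ∧ tn k < T) ∧ (∀ k, 0 < lamn k) ∧ Tendsto lamn atTop (𝓝 0) ∧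
      (∀ k, ∀ t ∈ Icc 0 (tn k), ∀ x, lamn k * ‖u t x‖ ≤ 1) ∧ StrictMono φ ∧ IsKNSSBlowupLimit W ∧
      (∀ s < 0, TendstoLocallyUniformly
        (fun k => (lamn (φ k) • stPull (lamn (φ k) ^ 2) (lamn (φ k)) (tn (φ k)) (cn (φ k)) u) s) (W s) atTop) ∧
      (∀ s t : ℝ, s < t → t < 0 → ∀ x,
        W t x = Literature.Analysis.UnboundedOperators.heatExtension (W s) (t - s) x - oseenDuhamel 1 s W W t x) ∧
      (∀ s < 0, ∀ y : EuclideanSpace ℝ (Fin 3), Tendsto (fun j => lamn (φ j) ^ 2 •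
        curl (u (tn (φ j) + lamn (φ j) ^ 2 * s)) (cn (φ j) + lamn (φ j) • y)) atTop (𝓝 (curl (W s) y))) ∧
      (((∀ s < 0, ∀ y : EuclideanSpace ℝ (Fin 3), Tendsto (fun j => lamn (φ j) ^ 2 •
            curl (u (tn (φ j) + lamn (φ j) ^ 2 * s)) (cn (φ j) + lamn (φ j) • y)) atTop (𝓝 0)) ∧
          ∃ c : EuclideanSpace ℝ (Fin 3), ‖c‖ = 1 ∧ c 1 = 0 ∧ ∀ s < 0, ∀ y : EuclideanSpace ℝ (Fin 3), W s y = c) ∨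
        ((∃ s < 0, ∃ y : EuclideanSpace ℝ (Fin 3), curl (W s) y ≠ 0 ∧ Tendsto (fun j => lamn (φ j) ^ 2 •
            curl (u (tn (φ j) + lamn (φ j) ^ 2 * s)) (cn (φ j) + lamn (φ j) • y)) atTop (𝓝 (curl (W s) y))) ∧
          ¬ Summit.NavierStokesRegularity.NavierStokesRegularity.AxisymmetricLiouvilleBoundedSwirl ∧
          (∀ s < 0, IsAxisymmetric (W s)) ∧ (∀ s < 0, ∀ y : EuclideanSpace ℝ (Fin 3), |swirl (W s) y| ≤ Mₛ) ∧
          (∃ s < 0, ∃ x : EuclideanSpace ℝ (Fin 3), W s x ≠ W s 0) ∧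
          (∃ s < 0, ∃ x : EuclideanSpace ℝ (Fin 3), swirl (W s) x ≠ 0) ∧
          (∀ C : ℝ, ∃ s < 0, ∃ x : EuclideanSpace ℝ (Fin 3), C < cylRadius x * ‖poloidalPart (W s) x‖) ∧
          (∀ q : ℝ≥0∞, 1 ≤ q → q < ⊤ → ∀ K : ℝ≥0, ∃ s < 0, (K : ℝ≥0∞) < eLpNorm (swirl (W s)) q volume) ∧
          ∃ ε : ℝ, 0 < ε ∧ ∀ R : ℝ, ∃ s < 0, ∃ x : EuclideanSpace ℝ (Fin 3),
            R ≤ cylRadius x ∧ ε < |swirl (W s) x|)) := by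
  obtain ⟨tn, lamn, cn, φ, W, htn, hlam, hlam0, hgauge, hφ, hW, hconv, hmild, hcurl, halt⟩ :=
    innerLimit_alternative_with_vorticity_of_singularity hT hmax hLH hbdd haxi hMₛ
  refine ⟨tn, lamn, cn, φ, W, htn, hlam, hlam0, hgauge, hφ, hW, hconv, hmild, hcurl, ?_⟩
  rcases halt with ⟨c, hc1, hc0, hc, hzero⟩ | ⟨hnot, hax, hsw, hnc, hrest⟩
  · exact Or.inl ⟨hzero, c, hc1, hc0, hc⟩
  · obtain ⟨s, hs, y, hy⟩ := (knssBlowupLimit_typeBeta_iff_exists_curl_ne_zero hW).1 hnc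
    exact Or.inr ⟨⟨s, hs, y, hy, hcurl s hs y⟩, hnot, hax, hsw, hnc, hrest⟩

end Discriminator

end TypeIIModulationDictionary
end Summit.NavierStokesRegularity.OSWSelfSimilar
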